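import Summits.CriticalPhenomena.SAWScalingLimit.Theorems.SAWDefectDecoherencePolygonParitySqueezeDefs
import Summits.CriticalPhenomena.SAWScalingLimit.Theorems.SAWDefectDecoherenceBoundaryClosureRGateMassLaws
import Summits.CriticalPhenomena.SAWScalingLimit.Theorems.SAWDefectDecoherenceBoundaryClosureRSqueezeSandwich
import HarnessLib

/-!
# Crux `BoundaryClosureR` (stmt-CriticalPhenomena-14004), line `polygon-parity-squeeze`,
# stub `gateProfile_of_identification` (piece F of the (A) assembly): lattice side sums

Bookkeeping of the `b`-normalised positive boundary arrival sums
`S_δ(w) := δ Σ_{e ∈ ∂Λ_δ} w(δ·mid e) ‖F₀(e)‖ / ‖F₀(b_δ)‖` (`F₀` = the spin-`0` observable, a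
nonnegative real) that feed the last step of the identification on exact polygons:

* `gateSum_eq_ofReal_add` — the COMPLEX gate functional of `GateProfileAt`,
  `δ Σ_{e ∈ ∂Λ, δ·mid e ∈ B} g(δ·mid e) F₀(e)/F₀(b)`, is `S_δ(re g) + i S_δ(im g)` when `g` vanishes
  off `B` (`F₀(e)/F₀(b)` is the real quotient of the masses, `obs_zero_div_eq_ofReal`);
* `eventually_sideSum_eq_zero_of_im_ne` — NO MASS OFF THE GATE LINE: for a compactly supported
  weight `w` supported in a closed sub-ball of the pinned ball and off the horizontal line through
  `pt 1`, `S_δ(w) = 0` eventually (the boundary mid-edges there are floor mid-edges of the gate row,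
  `GateMass.eventually_boundaryWindow_eq_image`, whose height converges to the line,
  `GateMass.tendsto_floorHeight`);
* `eventually_le_sideSum_of_ratioMixing`, `eventually_sideSum_le_of_ratioMixing` — the two halves
  of the RATIO-MIXING SANDWICH: a flat-top bump `w₊ = 1` on `B(pt 1, s + η)` dominates the window
  `B(δ·mid b_δ, s)` of `RatioMixingAt`, and a bump `w₋` supported in `B(pt 1, s − η)` is dominated by
  it, once `dist(δ·mid b_δ, pt 1) < η`; whence `2s(1 − ε) ≤ S_δ(w₊)` and `S_δ(w₋) ≤ 2s(1 + ε)`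
  eventually.

References: H. Duminil-Copin, S. Smirnov, Ann. of Math. 175 (2012), §3 (the boundary part `α` of
the strip); G. Lawler, O. Schramm, W. Werner (2004), §3.4.
-/

noncomputable section

open scoped BigOperators Topology
open Filter Set Metric
open Literature.Probability.LatticeModels Literature.Probability.RandomPlanarGeometry
open Literature.Probability.RandomPlanarGeometry.SAW
open Summit.CriticalPhenomena.SAWScalingLimit.Theorems.PickHalfPlane

namespace Summit.CriticalPhenomena.SAWScalingLimit.Theorems.PolygonParitySqueeze.GateProfile

/-! ### 1. The complex gate functional through the real side sums -/

/-- **The gate functional is `S(re g) + i S(im g)`.** If `g` vanishes off `B`, then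
`δ Σ_{e ∈ ∂Λ, δ·mid e ∈ B} g(δ·mid e) F₀(e)/F₀(b) = S_δ(re g) + i · S_δ(im g)` with
`S_δ(w) = δ Σ_{e ∈ ∂Λ} w(δ·mid e) ‖F₀(e)‖/‖F₀(b)‖`. [cite: DuminilCopinSmirnov2012, Def. 1] -/
theorem gateSum_eq_ofReal_add (Λ : Finset HexVertex) (a b : Sym2 HexVertex) (δ : ℝ) (g : ℂ → ℂ)
    (B : Set ℂ) (hg : ∀ z, z ∉ B → g z = 0) :
    (δ : ℂ) * ∑ᶠ e ∈ {e : Sym2 HexVertex | e ∈ hexDomainBoundary Λ ∧ (δ : ℂ) * hexMidpoint e ∈ B},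
        g ((δ : ℂ) * hexMidpoint e) *
          (hexParafermionicObservable Λ a hexCriticalFugacity 0 e /
            hexParafermionicObservable Λ a hexCriticalFugacity 0 b) =
      ((δ * ∑ᶠ e ∈ hexDomainBoundary Λ, (g ((δ : ℂ) * hexMidpoint e)).re *
          (‖hexParafermionicObservable Λ a hexCriticalFugacity 0 e‖ /
            ‖hexParafermionicObservable Λ a hexCriticalFugacity 0 b‖) : ℝ) : ℂ) +
      ((δ * ∑ᶠ e ∈ hexDomainBoundary Λ, (g ((δ : ℂ) * hexMidpoint e)).im *
          (‖hexParafermionicObservable Λ a hexCriticalFugacity 0 e‖ /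
            ‖hexParafermionicObservable Λ a hexCriticalFugacity 0 b‖) : ℝ) : ℂ) * Complex.I := by
  set r : Sym2 HexVertex → ℝ := fun e => ‖hexParafermionicObservable Λ a hexCriticalFugacity 0 e‖ /
    ‖hexParafermionicObservable Λ a hexCriticalFugacity 0 b‖ with hr
  have hfin := GateMass.finite_hexDomainBoundary Λ
  -- the window restriction is void: the summand vanishes off `B`
  have h1 : ∑ᶠ e ∈ {e : Sym2 HexVertex | e ∈ hexDomainBoundary Λ ∧ (δ : ℂ) * hexMidpoint e ∈ B},
        g ((δ : ℂ) * hexMidpoint e) *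
          (hexParafermionicObservable Λ a hexCriticalFugacity 0 e /
            hexParafermionicObservable Λ a hexCriticalFugacity 0 b) =
      ∑ᶠ e ∈ hexDomainBoundary Λ, g ((δ : ℂ) * hexMidpoint e) *
          (hexParafermionicObservable Λ a hexCriticalFugacity 0 e /
            hexParafermionicObservable Λ a hexCriticalFugacity 0 b) := by
    apply finsum_mem_inter_support_eq
    ext e
    simp only [mem_inter_iff, mem_setOf_eq, Function.mem_support]
    constructor
    · rintro ⟨⟨he, -⟩, hne⟩; exact ⟨he, hne⟩
    · rintro ⟨he, hne⟩
      refine ⟨⟨he, ?_⟩, hne⟩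
      by_contra hB
      exact hne (by rw [hg _ hB, zero_mul])
  -- termwise: `g · (F e / F b) = (re g) r + i (im g) r`
  have h2 : ∀ e, g ((δ : ℂ) * hexMidpoint e) *
        (hexParafermionicObservable Λ a hexCriticalFugacity 0 e /
          hexParafermionicObservable Λ a hexCriticalFugacity 0 b) =
      (((g ((δ : ℂ) * hexMidpoint e)).re * r e : ℝ) : ℂ) +
        (((g ((δ : ℂ) * hexMidpoint e)).im * r e : ℝ) : ℂ) * Complex.I := by
    intro e
    rw [obs_zero_div_eq_ofReal]
    conv_lhs => rw [← Complex.re_add_im (g ((δ : ℂ) * hexMidpoint e))]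
    simp only [hr]
    push_cast
    ring
  have h3 : ∑ e ∈ hfin.toFinset, g ((δ : ℂ) * hexMidpoint e) *
        (hexParafermionicObservable Λ a hexCriticalFugacity 0 e /
          hexParafermionicObservable Λ a hexCriticalFugacity 0 b) =
      ((∑ e ∈ hfin.toFinset, (g ((δ : ℂ) * hexMidpoint e)).re * r e : ℝ) : ℂ) +
        ((∑ e ∈ hfin.toFinset, (g ((δ : ℂ) * hexMidpoint e)).im * r e : ℝ) : ℂ) * Complex.I := by
    rw [Finset.sum_congr rfl fun e _ => h2 e, Finset.sum_add_distrib, ← Finset.sum_mul,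
      ← Complex.ofReal_sum, ← Complex.ofReal_sum]
  rw [h1, finsum_mem_eq_finite_toFinset_sum _ hfin, finsum_mem_eq_finite_toFinset_sum _ hfin,
    finsum_mem_eq_finite_toFinset_sum _ hfin, h3]
  simp only [hr]
  push_cast
  ring

/-! ### 2. No mass off the gate line -/

/-- **Side sums vanish off the gate line, eventually.** For an admissible family (pinned ball
`B(pt 1, ρ)`), a compactly supported weight `w` with `tsupport w ⊆ B̄(pt 1, ρ₁)`, `ρ₁ < ρ`, whose
support avoids the horizontal line through `pt 1`, the side sum `S_δ(w)` vanishes eventually in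
`δ → 0⁺`: the boundary mid-edges with scaled midpoint in `tsupport w` are floor mid-edges of the gate
row, all at height `δ · m δ · √3/2 → im (pt 1)`, while `tsupport w` stays at positive distance from
the line. [cite: DuminilCopinSmirnov2012, §3 (the boundary part α of the strip)] -/
theorem eventually_sideSum_eq_zero_of_im_ne {D : DobrushinDomain} {ρ : ℝ} {Λ : ℝ → Finset HexVertex}
    {m : ℝ → ℤ} {b : ℝ → Sym2 HexVertex} (hAF : AdmissibleFamily D ρ Λ m b)
    (a : ℝ → Sym2 HexVertex) {w : ℂ → ℝ} (hwc : HasCompactSupport w) {ρ₁ : ℝ} (hρ₁ : ρ₁ < ρ)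
    (hw1 : tsupport w ⊆ closedBall (D.pt 1) ρ₁) (hw2 : ∀ z ∈ tsupport w, z.im ≠ (D.pt 1).im) :
    ∀ᶠ δ : ℝ in 𝓝[>] 0, δ * ∑ᶠ e ∈ hexDomainBoundary (Λ δ), w ((δ : ℂ) * hexMidpoint e) *
        (‖hexParafermionicObservable (Λ δ) (a δ) hexCriticalFugacity 0 e‖ /
          ‖hexParafermionicObservable (Λ δ) (a δ) hexCriticalFugacity 0 (b δ)‖) = 0 := by
  obtain ⟨hρ, -, hadm, -, hblim⟩ := hAF
  have hpin : ∀ᶠ δ : ℝ in 𝓝[>] 0, ∀ v : HexVertex,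
      (δ : ℂ) * hexCenter v ∈ ball (D.pt 1) ρ → (v ∈ Λ δ ↔ m δ ≤ v.1 1) :=
    hadm.mono fun δ h => h.2.2.2.2
  have hb : ∀ᶠ δ : ℝ in 𝓝[>] 0, b δ ∈ hexDomainBoundary (Λ δ) := hadm.mono fun δ h => h.2.1
  -- a positive gap between the support of `w` and the line
  obtain ⟨ε, hε, hgap⟩ : ∃ ε : ℝ, 0 < ε ∧ ∀ z ∈ tsupport w, ε ≤ |z.im - (D.pt 1).im| := by
    by_cases hne : (tsupport w).Nonempty
    · obtain ⟨z₀, hz₀, hmin⟩ := hwc.isCompact.exists_isMinOn hne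
        ((Complex.continuous_im.sub continuous_const).abs).continuousOn
      exact ⟨|z₀.im - (D.pt 1).im|, abs_pos.2 (sub_ne_zero.2 (hw2 z₀ hz₀)), fun z hz => hmin hz⟩
    · exact ⟨1, one_pos, fun z hz => absurd ⟨z, hz⟩ hne⟩
  have hclose : ∀ᶠ δ : ℝ in 𝓝[>] 0, dist (δ * (m δ : ℝ) * (Real.sqrt 3 / 2)) (D.pt 1).im < ε :=
    Metric.tendsto_nhds.1 (GateMass.tendsto_floorHeight hρ hpin hb hblim) ε hε
  have hW := GateMass.eventually_boundaryWindow_eq_image (y := D.pt 1) (ρ' := ρ₁) hpin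
    (closedBall_subset_ball hρ₁)
  filter_upwards [hW, hclose] with δ hWδ hcl
  have hzero : EqOn (fun e => w ((δ : ℂ) * hexMidpoint e) *
      (‖hexParafermionicObservable (Λ δ) (a δ) hexCriticalFugacity 0 e‖ /
        ‖hexParafermionicObservable (Λ δ) (a δ) hexCriticalFugacity 0 (b δ)‖)) 0
      (hexDomainBoundary (Λ δ)) := by
    intro e he
    simp only [Pi.zero_apply]
    suffices hw0 : w ((δ : ℂ) * hexMidpoint e) = 0 by rw [hw0, zero_mul]
    by_contra hw0
    have hmem : (δ : ℂ) * hexMidpoint e ∈ tsupport w := subset_tsupport _ (Function.mem_support.2 hw0)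
    have hwin : e ∈ {e : Sym2 HexVertex | e ∈ hexDomainBoundary (Λ δ) ∧
        (δ : ℂ) * hexMidpoint e ∈ tsupport w} := ⟨he, hmem⟩
    rw [hWδ (tsupport w) hw1] at hwin
    obtain ⟨k, hk, hke⟩ := hwin
    have him : ((δ : ℂ) * hexMidpoint e).im = δ * (m δ : ℝ) * (Real.sqrt 3 / 2) := by
      rw [← hke, Complex.mul_im, Complex.ofReal_re, Complex.ofReal_im,
        GateMass.im_hexMidpoint_floorEdge']
      ring
    have h1 := hgap _ hmem
    rw [him] at h1
    rw [Real.dist_eq] at hcl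
    linarith
  rw [finsum_mem_of_eqOn_zero hzero, mul_zero]

/-! ### 3. The ratio-mixing sandwich -/

/-- **Lower half of the sandwich.** If eventually `|δ/(2s) · Σ_{δ·mid e ∈ B(δ·mid b_δ, s)} ‖F₀ e‖/‖F₀ b_δ‖ − 1| ≤ ε`
(one instance of `RatioMixingAt`) and `w ≥ 0` equals `1` on `B(pt 1, s + η)` (`η > 0`), then
eventually `2s(1 − ε) ≤ S_δ(w)`: once `dist(δ·mid b_δ, pt 1) < η` the window is inside the flat top.
[cite: LawlerSchrammWerner2004SAW, §3.4 (restriction / boundary scaling heuristics)] -/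
theorem eventually_le_sideSum_of_ratioMixing {D : DobrushinDomain} {ρ : ℝ}
    {Λ : ℝ → Finset HexVertex} {m : ℝ → ℤ} {b : ℝ → Sym2 HexVertex} (hAF : AdmissibleFamily D ρ Λ m b)
    (a : ℝ → Sym2 HexVertex) {s ε η : ℝ} (hs : 0 < s) (hη : 0 < η)
    (hRM : ∀ᶠ δ : ℝ in 𝓝[>] 0,
      |δ / (2 * s) * (∑ᶠ e ∈ {e : Sym2 HexVertex | e ∈ hexDomainBoundary (Λ δ) ∧
          (δ : ℂ) * hexMidpoint e ∈ ball ((δ : ℂ) * hexMidpoint (b δ)) s},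
        ‖hexParafermionicObservable (Λ δ) (a δ) hexCriticalFugacity 0 e‖ /
          ‖hexParafermionicObservable (Λ δ) (a δ) hexCriticalFugacity 0 (b δ)‖) - 1| ≤ ε)
    {w : ℂ → ℝ} (hw0 : ∀ z, 0 ≤ w z) (hw1 : ∀ z ∈ ball (D.pt 1) (s + η), w z = 1) :
    ∀ᶠ δ : ℝ in 𝓝[>] 0, 2 * s * (1 - ε) ≤
      δ * ∑ᶠ e ∈ hexDomainBoundary (Λ δ), w ((δ : ℂ) * hexMidpoint e) *
        (‖hexParafermionicObservable (Λ δ) (a δ) hexCriticalFugacity 0 e‖ /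
          ‖hexParafermionicObservable (Λ δ) (a δ) hexCriticalFugacity 0 (b δ)‖) := by
  have hbnear : ∀ᶠ δ : ℝ in 𝓝[>] 0, dist ((δ : ℂ) * hexMidpoint (b δ)) (D.pt 1) < η :=
    Metric.tendsto_nhds.1 hAF.2.2.2.2 η hη
  have hδpos : ∀ᶠ δ : ℝ in 𝓝[>] 0, 0 < δ := eventually_mem_nhdsWithin
  refine (hRM.and (hbnear.and hδpos)).mono fun δ hh => ?_
  obtain ⟨hR, hbδ, hδ⟩ := hh
  set r : Sym2 HexVertex → ℝ := fun e =>
    ‖hexParafermionicObservable (Λ δ) (a δ) hexCriticalFugacity 0 e‖ /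
      ‖hexParafermionicObservable (Λ δ) (a δ) hexCriticalFugacity 0 (b δ)‖ with hr
  set W : Set (Sym2 HexVertex) := {e : Sym2 HexVertex | e ∈ hexDomainBoundary (Λ δ) ∧
    (δ : ℂ) * hexMidpoint e ∈ ball ((δ : ℂ) * hexMidpoint (b δ)) s} with hW
  have hfinW : W.Finite := GateMass.finite_boundaryWindow _ _
  have hfin : (hexDomainBoundary (Λ δ)).Finite := GateMass.finite_hexDomainBoundary _
  have hlow : 2 * s * (1 - ε) ≤ δ * ∑ᶠ e ∈ W, r e := by
    have h := (abs_sub_le_iff.1 hR).2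
    have h1 : 1 - ε ≤ δ / (2 * s) * ∑ᶠ e ∈ W, r e := by linarith
    calc 2 * s * (1 - ε) ≤ 2 * s * (δ / (2 * s) * ∑ᶠ e ∈ W, r e) :=
          mul_le_mul_of_nonneg_left h1 (by positivity)
      _ = δ * ∑ᶠ e ∈ W, r e := by field_simp
  have hcomp : ∑ᶠ e ∈ W, r e ≤
      ∑ᶠ e ∈ hexDomainBoundary (Λ δ), w ((δ : ℂ) * hexMidpoint e) * r e := by
    rw [finsum_mem_eq_finite_toFinset_sum _ hfinW, finsum_mem_eq_finite_toFinset_sum _ hfin]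
    have hsub : hfinW.toFinset ⊆ hfin.toFinset := by
      intro e he
      rw [Set.Finite.mem_toFinset] at he ⊢
      exact he.1
    calc ∑ e ∈ hfinW.toFinset, r e = ∑ e ∈ hfinW.toFinset, w ((δ : ℂ) * hexMidpoint e) * r e := by
          refine Finset.sum_congr rfl fun e he => ?_
          rw [Set.Finite.mem_toFinset] at he
          rw [hw1 _ ?_, one_mul]
          rw [mem_ball]
          calc dist ((δ : ℂ) * hexMidpoint e) (D.pt 1)
              ≤ dist ((δ : ℂ) * hexMidpoint e) ((δ : ℂ) * hexMidpoint (b δ)) +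
                  dist ((δ : ℂ) * hexMidpoint (b δ)) (D.pt 1) := dist_triangle _ _ _
            _ < s + η := add_lt_add (mem_ball.1 he.2) hbδ
      _ ≤ ∑ e ∈ hfin.toFinset, w ((δ : ℂ) * hexMidpoint e) * r e :=
          Finset.sum_le_sum_of_subset_of_nonneg hsub fun e _ _ =>
            mul_nonneg (hw0 _) (div_nonneg (norm_nonneg _) (norm_nonneg _))
  calc 2 * s * (1 - ε) ≤ δ * ∑ᶠ e ∈ W, r e := hlow
    _ ≤ δ * ∑ᶠ e ∈ hexDomainBoundary (Λ δ), w ((δ : ℂ) * hexMidpoint e) * r e :=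
        mul_le_mul_of_nonneg_left hcomp hδ.le

/-- **Upper half of the sandwich.** With the same instance of `RatioMixingAt`, if `w ≤ 1` and
`w` vanishes off `B(pt 1, s − η)` (`η > 0`), then eventually `S_δ(w) ≤ 2s(1 + ε)`: once
`dist(δ·mid b_δ, pt 1) < η` the support of `w` is inside the window.
[cite: LawlerSchrammWerner2004SAW, §3.4 (restriction / boundary scaling heuristics)] -/
theorem eventually_sideSum_le_of_ratioMixing {D : DobrushinDomain} {ρ : ℝ}
    {Λ : ℝ → Finset HexVertex} {m : ℝ → ℤ} {b : ℝ → Sym2 HexVertex} (hAF : AdmissibleFamily D ρ Λ m b)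
    (a : ℝ → Sym2 HexVertex) {s ε η : ℝ} (hs : 0 < s) (hη : 0 < η)
    (hRM : ∀ᶠ δ : ℝ in 𝓝[>] 0,
      |δ / (2 * s) * (∑ᶠ e ∈ {e : Sym2 HexVertex | e ∈ hexDomainBoundary (Λ δ) ∧
          (δ : ℂ) * hexMidpoint e ∈ ball ((δ : ℂ) * hexMidpoint (b δ)) s},
        ‖hexParafermionicObservable (Λ δ) (a δ) hexCriticalFugacity 0 e‖ /
          ‖hexParafermionicObservable (Λ δ) (a δ) hexCriticalFugacity 0 (b δ)‖) - 1| ≤ ε)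
    {w : ℂ → ℝ} (hwle : ∀ z, w z ≤ 1) (hw2 : ∀ z, w z ≠ 0 → z ∈ ball (D.pt 1) (s - η)) :
    ∀ᶠ δ : ℝ in 𝓝[>] 0,
      δ * ∑ᶠ e ∈ hexDomainBoundary (Λ δ), w ((δ : ℂ) * hexMidpoint e) *
        (‖hexParafermionicObservable (Λ δ) (a δ) hexCriticalFugacity 0 e‖ /
          ‖hexParafermionicObservable (Λ δ) (a δ) hexCriticalFugacity 0 (b δ)‖) ≤ 2 * s * (1 + ε) := by
  have hbnear : ∀ᶠ δ : ℝ in 𝓝[>] 0, dist ((δ : ℂ) * hexMidpoint (b δ)) (D.pt 1) < η :=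
    Metric.tendsto_nhds.1 hAF.2.2.2.2 η hη
  have hδpos : ∀ᶠ δ : ℝ in 𝓝[>] 0, 0 < δ := eventually_mem_nhdsWithin
  refine (hRM.and (hbnear.and hδpos)).mono fun δ hh => ?_
  obtain ⟨hR, hbδ, hδ⟩ := hh
  set r : Sym2 HexVertex → ℝ := fun e =>
    ‖hexParafermionicObservable (Λ δ) (a δ) hexCriticalFugacity 0 e‖ /
      ‖hexParafermionicObservable (Λ δ) (a δ) hexCriticalFugacity 0 (b δ)‖ with hr
  set W : Set (Sym2 HexVertex) := {e : Sym2 HexVertex | e ∈ hexDomainBoundary (Λ δ) ∧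
    (δ : ℂ) * hexMidpoint e ∈ ball ((δ : ℂ) * hexMidpoint (b δ)) s} with hW
  have hfinW : W.Finite := GateMass.finite_boundaryWindow _ _
  have hup : δ * ∑ᶠ e ∈ W, r e ≤ 2 * s * (1 + ε) := by
    have h := (abs_sub_le_iff.1 hR).1
    have h1 : δ / (2 * s) * ∑ᶠ e ∈ W, r e ≤ 1 + ε := by linarith
    calc δ * ∑ᶠ e ∈ W, r e = 2 * s * (δ / (2 * s) * ∑ᶠ e ∈ W, r e) := by field_simp
      _ ≤ 2 * s * (1 + ε) := mul_le_mul_of_nonneg_left h1 (by positivity)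
  -- the side sum lives on the window
  have hwin : ∑ᶠ e ∈ hexDomainBoundary (Λ δ), w ((δ : ℂ) * hexMidpoint e) * r e =
      ∑ᶠ e ∈ W, w ((δ : ℂ) * hexMidpoint e) * r e := by
    apply finsum_mem_inter_support_eq
    ext e
    simp only [mem_inter_iff, hW, mem_setOf_eq, Function.mem_support]
    constructor
    · rintro ⟨he, hne⟩
      refine ⟨⟨he, ?_⟩, hne⟩
      have hwne : w ((δ : ℂ) * hexMidpoint e) ≠ 0 := fun h0 => hne (by rw [h0, zero_mul])
      have hz := mem_ball.1 (hw2 _ hwne)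
      rw [mem_ball]
      calc dist ((δ : ℂ) * hexMidpoint e) ((δ : ℂ) * hexMidpoint (b δ))
          ≤ dist ((δ : ℂ) * hexMidpoint e) (D.pt 1) + dist (D.pt 1) ((δ : ℂ) * hexMidpoint (b δ)) :=
            dist_triangle _ _ _
        _ < (s - η) + η := by rw [dist_comm (D.pt 1)]; exact add_lt_add hz hbδ
        _ = s := by ring
    · rintro ⟨⟨he, -⟩, hne⟩; exact ⟨he, hne⟩
  have hcomp : ∑ᶠ e ∈ W, w ((δ : ℂ) * hexMidpoint e) * r e ≤ ∑ᶠ e ∈ W, r e := by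
    rw [finsum_mem_eq_finite_toFinset_sum _ hfinW, finsum_mem_eq_finite_toFinset_sum _ hfinW]
    refine Finset.sum_le_sum fun e _ => ?_
    have hr0 : 0 ≤ r e := div_nonneg (norm_nonneg _) (norm_nonneg _)
    calc w ((δ : ℂ) * hexMidpoint e) * r e ≤ 1 * r e := mul_le_mul_of_nonneg_right (hwle _) hr0
      _ = r e := one_mul _
  calc δ * ∑ᶠ e ∈ hexDomainBoundary (Λ δ), w ((δ : ℂ) * hexMidpoint e) * r e
      = δ * ∑ᶠ e ∈ W, w ((δ : ℂ) * hexMidpoint e) * r e := by rw [hwin]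
    _ ≤ δ * ∑ᶠ e ∈ W, r e := mul_le_mul_of_nonneg_left hcomp hδ.le
    _ ≤ 2 * s * (1 + ε) := hup

/-! ### Registered form (sub-goal of `gateProfile_of_identification`) -/

/-- **Registered sub-goal `gateProfile_sideSumOffLine`** (crux item stmt-CriticalPhenomena-14004, line
`polygon-parity-squeeze`, stub `gateProfile_of_identification`, piece F of the (A) assembly): registry
form (one `∀`-term) of `eventually_sideSum_eq_zero_of_im_ne` — the normalised boundary arrival sums
carry no mass off the gate line near the normaliser.
[cite: DuminilCopinSmirnov2012, §3 (the boundary part α of the strip)] -/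
theorem gateProfile_sideSumOffLine : ∀ (D : DobrushinDomain) (ρ : ℝ) (Λ : ℝ → Finset HexVertex) (m : ℝ → ℤ) (b : ℝ → Sym2 HexVertex), AdmissibleFamily D ρ Λ m b → ∀ (a : ℝ → Sym2 HexVertex) (w : ℂ → ℝ) (ρ₁ : ℝ), HasCompactSupport w → ρ₁ < ρ → tsupport w ⊆ Metric.closedBall (D.pt 1) ρ₁ → (∀ z ∈ tsupport w, z.im ≠ (D.pt 1).im) → ∀ᶠ δ : ℝ in 𝓝[>] 0, δ * ∑ᶠ e ∈ hexDomainBoundary (Λ δ), w ((δ : ℂ) * hexMidpoint e) * (‖hexParafermionicObservable (Λ δ) (a δ) hexCriticalFugacity 0 e‖ / ‖hexParafermionicObservable (Λ δ) (a δ) hexCriticalFugacity 0 (b δ)‖) = 0 :=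
  fun _ _ _ _ _ hAF a _ _ hwc hρ₁ hw1 hw2 => eventually_sideSum_eq_zero_of_im_ne hAF a hwc hρ₁ hw1 hw2

end Summit.CriticalPhenomena.SAWScalingLimit.Theorems.PolygonParitySqueeze.GateProfile

end
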